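import Literature.NumberTheory.LFunctions.FordProgram1
import HarnessLib

/-!
# Ford's "Program 1": kernel run 10A (`565 ≤ k ≤ 574`)

Topic `Literature/NumberTheory/LFunctions`. Everything here is PROVED (kernel evaluations, standard
axioms): `FordP1.checkT k = true` for `565 ≤ k ≤ 574`, i.e. the certified re-run of PROGRAM 1 of
K. Ford, Proc. LMS 85 (2002) (the second part of Theorem 3) for these `k` — see `FordProgram1.lean`
for the checker, its soundness `FordP1.row_of_checkK`, and the meaning of the constants
(`ρ = FordP1.rhoOf k / 10⁵`, `θ = FordP1.thetaOf k / 10⁴`, `ω = FordP1.omOf k / 10⁴`). One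
`decide +kernel` per `k` (so that the kernel's evaluation state is bounded by a single run;
`maxHeartbeats 0` lifts the deterministic time-out for each), then the range statement
`FordP1.run10A`. The three parts 10A–10C are re-assembled in the original `List.all` form as
`FordP1.run10` (`FordProgram1Run10.lean`), which the assembly `FordTheorem3SmallK.lean` uses.

## References

* K. Ford, Proc. London Math. Soc. (3) 85 (2002), 565–633; arXiv:1910.08209: Theorem 3, (1.7),
  Lemmas 3.4–3.5, Appendix "PROGRAM 1". [Ford2002]
-/

namespace Literature.NumberTheory.LFunctions
namespace FordP1

set_option maxHeartbeats 0 in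
/-- `checkT 565`. [cite: Ford2002, Theorem 3 (second part) and PROGRAM 1] -/
theorem checkT_565 : checkT 565 = true := by
  decide +kernel

set_option maxHeartbeats 0 in
/-- `checkT 566`. [cite: Ford2002, Theorem 3 (second part) and PROGRAM 1] -/
theorem checkT_566 : checkT 566 = true := by
  decide +kernel

set_option maxHeartbeats 0 in
/-- `checkT 567`. [cite: Ford2002, Theorem 3 (second part) and PROGRAM 1] -/
theorem checkT_567 : checkT 567 = true := by
  decide +kernel

set_option maxHeartbeats 0 in
/-- `checkT 568`. [cite: Ford2002, Theorem 3 (second part) and PROGRAM 1] -/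
theorem checkT_568 : checkT 568 = true := by
  decide +kernel

set_option maxHeartbeats 0 in
/-- `checkT 569`. [cite: Ford2002, Theorem 3 (second part) and PROGRAM 1] -/
theorem checkT_569 : checkT 569 = true := by
  decide +kernel

set_option maxHeartbeats 0 in
/-- `checkT 570`. [cite: Ford2002, Theorem 3 (second part) and PROGRAM 1] -/
theorem checkT_570 : checkT 570 = true := by
  decide +kernel

set_option maxHeartbeats 0 in
/-- `checkT 571`. [cite: Ford2002, Theorem 3 (second part) and PROGRAM 1] -/
theorem checkT_571 : checkT 571 = true := by
  decide +kernel

set_option maxHeartbeats 0 in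
/-- `checkT 572`. [cite: Ford2002, Theorem 3 (second part) and PROGRAM 1] -/
theorem checkT_572 : checkT 572 = true := by
  decide +kernel

set_option maxHeartbeats 0 in
/-- `checkT 573`. [cite: Ford2002, Theorem 3 (second part) and PROGRAM 1] -/
theorem checkT_573 : checkT 573 = true := by
  decide +kernel

set_option maxHeartbeats 0 in
/-- `checkT 574`. [cite: Ford2002, Theorem 3 (second part) and PROGRAM 1] -/
theorem checkT_574 : checkT 574 = true := by
  decide +kernel

/-- **Kernel run 10A**: `checkT k` for `565 ≤ k ≤ 574`. [cite: Ford2002, Theorem 3 (second part)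
and PROGRAM 1] -/
theorem run10A (k : ℕ) (h1 : 565 ≤ k) (h2 : k ≤ 574) : checkT k = true := by
  interval_cases k
  · exact checkT_565
  · exact checkT_566
  · exact checkT_567
  · exact checkT_568
  · exact checkT_569
  · exact checkT_570
  · exact checkT_571
  · exact checkT_572
  · exact checkT_573
  · exact checkT_574

end FordP1
end Literature.NumberTheory.LFunctions
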